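import Mathlib
import Summits.Ventures.PercRepro2.Defs
import Summits.Ventures.PercRepro2.Harris
import Summits.Ventures.PercRepro2.Graph
import Summits.Ventures.PercRepro2.Events
import Summits.Ventures.PercRepro2.PsiPinInduction
import Summits.Ventures.PercRepro2.PsiUniSure
import Summits.Ventures.PercRepro2.PsiUniExplored
import Summits.Ventures.PercRepro2.PsiTEdge
import Summits.Ventures.PercRepro2.R21PinInduction
import Summits.Ventures.PercRepro2.R21OEdgeSGraph
import Summits.Ventures.PercRepro2.R21OEdgeU

/-!
# The edge to `u` of the `o`-exploration for the boundary derivative `R⁺` (PercRepro2, p2)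

The `u`-edge case of (UNI-R⁺_o), `R⁺ = R + D_y`, by a certificate: for an unpinned edge `f = {x, u}`
with `x` in the explored `o`-component, in the closed-world cells
`A = P(h 𝟙 Y_u)`, `E = P(h 𝟙 aᶜ Y_uᶜ)`, `F = P(a 𝟙 hᶜ ℓᶜ Y_uᶜ)`, `G = P(Y_u 𝟙 ℓᶜ hᶜ)`, `B = P(a ℓ 𝟙)`,
`K₁ = P(hᶜ S aᶜ O_uᶜ)`, `K₂ = P(h S aᶜ)` (`S = {s ↔ y}`, `O_u = {o ↔ u}`),

  `T⁺_f − R⁺(p[f↦0]) − R⁺(p[f↦1]) = (A + E)·(B + F) + (F + G)·(E + K₂ + K₁)`  (identically),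

so `2·min(R⁺⁰, R⁺¹) ≤ R⁺⁰ + R⁺¹ ≤ T⁺_f` with no induction hypothesis.  The `D_y`-part alone has a
defect of either sign (negative in ≈ 35 % of random instances); the surplus of the `R`-part
(`r21_uni_o_edge_u`) absorbs it — found by expanding the defect in the fifteen connectivity cells of
`{s, o, y, u}` (all coefficients nonnegative).

* `uEdge_dy_transfer` — the seven `D_y`-masses of the open world (two vanish);
* `uEdge_dy_masses` — the closed-world relations;
* `rplus_uni_o_edge_u` — **the `u`-edge case of (UNI-R⁺_o)**.
-/

namespace Summit.Ventures.PercRepro2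

section UEdgePlusProb

variable {V : Type*} {E : Type*} [Fintype E] [DecidableEq E]
  {R : Type*} [CommRing R] [LinearOrder R] [IsStrictOrderedRing R]

omit [IsStrictOrderedRing R] in
/-- The `D_y`-masses of the open world `p[f↦1]` of a `u`-edge as closed-world masses: `P(aᶜ h Y_u)` and
`P(hᶜ S a)` vanish (`a` and `h` coincide in the open world), `P(aᶜ S O_u)` and `P(hᶜ S)` become
`P(aᶜ hᶜ S)`, `P(𝟙 hᶜ ℓᶜ)` becomes `P(𝟙 aᶜ hᶜ ℓᶜ Y_uᶜ)`. -/
lemma uEdge_dy_transfer (p : E → R) (ends : E → Sym2 V) (s y o u x : V) (f : E)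
    (hf : ends f = s(x, u)) (hx : Conn ends (fun e => decide (p e = 1)) o x) (hpf : p f ≠ 1) :
    prob (Function.update p f 1) ((connEvent ends s u)ᶜ ∩ connEvent ends s o ∩ connEvent ends y u) = 0 ∧
      prob (Function.update p f 1) ((connEvent ends s u)ᶜ ∩ connEvent ends s y ∩ connEvent ends o u) = prob (Function.update p f 0) ((connEvent ends s u)ᶜ ∩ (connEvent ends s o)ᶜ ∩ connEvent ends s y) ∧
      prob (Function.update p f 1) ((connEvent ends s y)ᶜ ∩ (connEvent ends s o)ᶜ ∩ (connEvent ends y o)ᶜ) = prob (Function.update p f 0) ((connEvent ends s y)ᶜ ∩ (connEvent ends s u)ᶜ ∩ (connEvent ends s o)ᶜ ∩ (connEvent ends y o)ᶜ ∩ (connEvent ends y u)ᶜ) ∧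
      prob (Function.update p f 1) ((connEvent ends s o)ᶜ ∩ connEvent ends s y ∩ connEvent ends s u) = 0 ∧
      prob (Function.update p f 1) ((connEvent ends s o)ᶜ ∩ connEvent ends s y) = prob (Function.update p f 0) ((connEvent ends s u)ᶜ ∩ (connEvent ends s o)ᶜ ∩ connEvent ends s y) := by
  have key : ∀ (A A' : Set (Config E)),
      (∀ ω : Config E, (∀ e, e ≠ f → p e = 1 → ω e = true) →
        (Function.update ω f true ∈ A ↔ Function.update ω f false ∈ A')) →
      prob (Function.update p f 1) A = prob (Function.update p f 0) A' :=
    fun A A' h => prob_update_one_eq_prob_update_zero_of_respects p f fun ω _ h1 => h ω h1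
  have h0 : prob (Function.update p f 0) (∅ : Set (Config E)) = 0 := prob_empty _
  have hsv : ∀ (ω : Config E), (∀ e, e ≠ f → p e = 1 → ω e = true) → ∀ v,
      Conn ends (Function.update ω f true) s v ↔
        Conn ends (Function.update ω f false) s v ∨
          (Conn ends (Function.update ω f false) s o ∧ Conn ends (Function.update ω f false) u v) ∨
          (Conn ends (Function.update ω f false) s u ∧ Conn ends (Function.update ω f false) o v) :=
    fun ω h1 v => conn_update_true_s_iff_u hf hx hpf h1 v
  have hyo : ∀ (ω : Config E), (∀ e, e ≠ f → p e = 1 → ω e = true) →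
      (Conn ends (Function.update ω f true) y o ↔
        Conn ends (Function.update ω f false) y o ∨ Conn ends (Function.update ω f false) y u) :=
    fun ω h1 => conn_update_true_y_o_iff_u hf hx hpf h1
  have hyu : ∀ (ω : Config E), (∀ e, e ≠ f → p e = 1 → ω e = true) →
      (Conn ends (Function.update ω f true) y u ↔
        Conn ends (Function.update ω f false) y u ∨ Conn ends (Function.update ω f false) y o) := by
    intro ω h1
    rw [conn_update_true_iff_or hf]
    have hyx : Conn ends (Function.update ω f false) y x ↔ Conn ends (Function.update ω f false) y o :=
      ⟨fun h => conn_symm ((conn_x_iff_o hx hpf h1 y).1 (conn_symm h)),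
       fun h => conn_symm ((conn_x_iff_o hx hpf h1 y).2 (conn_symm h))⟩
    rw [hyx]
    constructor
    · rintro (h | ⟨h, _⟩ | ⟨h, _⟩)
      · exact Or.inl h
      · exact Or.inr h
      · exact Or.inl h
    · rintro (h | h)
      · exact Or.inl h
      · exact Or.inr (Or.inl ⟨h, conn_refl _ _ _⟩)
  have hou : ∀ (ω : Config E), (∀ e, e ≠ f → p e = 1 → ω e = true) →
      Conn ends (Function.update ω f true) o u := by
    intro ω h1
    rw [conn_update_true_iff_or hf]
    exact Or.inr (Or.inl ⟨conn_symm ((conn_x_iff_o hx hpf h1 o).2 (conn_refl _ _ _)), conn_refl _ _ _⟩)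
  have hAH : ∀ (ω : Config E), (∀ e, e ≠ f → p e = 1 → ω e = true) →
      ((Conn ends (Function.update ω f true) s u ↔
        Conn ends (Function.update ω f false) s u ∨ Conn ends (Function.update ω f false) s o) ∧
       (Conn ends (Function.update ω f true) s o ↔
        Conn ends (Function.update ω f false) s u ∨ Conn ends (Function.update ω f false) s o)) := by
    intro ω h1
    constructor
    · rw [hsv ω h1 u]
      constructor
      · rintro (h | ⟨hso, _⟩ | ⟨hsu, _⟩)
        · exact Or.inl h
        · exact Or.inr hso
        · exact Or.inl hsu
      · rintro (h | h)
        · exact Or.inl h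
        · exact Or.inr (Or.inl ⟨h, conn_refl _ _ _⟩)
    · rw [hsv ω h1 o]
      constructor
      · rintro (h | ⟨hso, _⟩ | ⟨hsu, _⟩)
        · exact Or.inr h
        · exact Or.inr hso
        · exact Or.inl hsu
      · rintro (h | h)
        · exact Or.inr (Or.inr ⟨h, conn_refl _ _ _⟩)
        · exact Or.inl h
  refine ⟨?_, ?_, ?_, ?_, ?_⟩
  · refine (key _ ∅ fun ω h1 => ?_).trans h0
    simp only [Set.mem_inter_iff, mem_connEvent, Set.mem_compl_iff, (hAH ω h1).1, (hAH ω h1).2,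
      Set.mem_empty_iff_false, iff_false, not_or]
    tauto
  · refine key _ _ fun ω h1 => ?_
    simp only [Set.mem_inter_iff, mem_connEvent, Set.mem_compl_iff, (hAH ω h1).1, hsv ω h1 y,
      hou ω h1, and_true, not_or]
    tauto
  · refine key _ _ fun ω h1 => ?_
    simp only [Set.mem_inter_iff, mem_connEvent, Set.mem_compl_iff, (hAH ω h1).2, hsv ω h1 y,
      hyo ω h1, not_or]
    tauto
  · refine (key _ ∅ fun ω h1 => ?_).trans h0
    simp only [Set.mem_inter_iff, mem_connEvent, Set.mem_compl_iff, (hAH ω h1).1, (hAH ω h1).2,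
      Set.mem_empty_iff_false, iff_false, not_or]
    tauto
  · refine key _ _ fun ω h1 => ?_
    simp only [Set.mem_inter_iff, mem_connEvent, Set.mem_compl_iff, (hAH ω h1).2, hsv ω h1 y, not_or]
    tauto

omit [LinearOrder R] [IsStrictOrderedRing R] in
/-- Closed-world relations for the `D_y`-masses at a `u`-edge. -/
lemma uEdge_dy_masses (q : E → R) (ends : E → Sym2 V) (s y o u : V) :
    prob q ((connEvent ends s u)ᶜ ∩ connEvent ends s o ∩ connEvent ends y u) = prob q (connEvent ends s o ∩ (connEvent ends s y)ᶜ ∩ connEvent ends u y) ∧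
      prob q ((connEvent ends s y)ᶜ ∩ (connEvent ends s o)ᶜ ∩ (connEvent ends y o)ᶜ) = prob q ((connEvent ends s y)ᶜ ∩ (connEvent ends s u)ᶜ ∩ (connEvent ends s o)ᶜ ∩ (connEvent ends y o)ᶜ ∩ (connEvent ends y u)ᶜ) + prob q (connEvent ends s u ∩ (connEvent ends s y)ᶜ ∩ (connEvent ends s o)ᶜ ∩ (connEvent ends o y)ᶜ ∩ (connEvent ends u y)ᶜ) + prob q (connEvent ends y u ∩ (connEvent ends s y)ᶜ ∩ (connEvent ends y o)ᶜ ∩ (connEvent ends s o)ᶜ) ∧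
      prob q ((connEvent ends s o)ᶜ ∩ connEvent ends s y) = prob q ((connEvent ends s o)ᶜ ∩ connEvent ends s y ∩ (connEvent ends s u)ᶜ ∩ (connEvent ends o u)ᶜ) + prob q ((connEvent ends s o)ᶜ ∩ connEvent ends s y ∩ connEvent ends s u) + prob q ((connEvent ends s o)ᶜ ∩ connEvent ends s y ∩ (connEvent ends s u)ᶜ ∩ connEvent ends o u) ∧
      prob q ((connEvent ends s u)ᶜ ∩ connEvent ends s y ∩ connEvent ends o u) = prob q ((connEvent ends s o)ᶜ ∩ connEvent ends s y ∩ (connEvent ends s u)ᶜ ∩ connEvent ends o u) ∧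
      prob q ((connEvent ends s u)ᶜ ∩ (connEvent ends s o)ᶜ ∩ connEvent ends s y) = prob q ((connEvent ends s o)ᶜ ∩ connEvent ends s y ∩ (connEvent ends s u)ᶜ ∩ (connEvent ends o u)ᶜ) + prob q ((connEvent ends s o)ᶜ ∩ connEvent ends s y ∩ (connEvent ends s u)ᶜ ∩ connEvent ends o u) ∧
      prob q (connEvent ends s u ∩ (connEvent ends s o)ᶜ) = prob q (connEvent ends s u ∩ connEvent ends y o ∩ (connEvent ends s y)ᶜ) + prob q (connEvent ends s u ∩ (connEvent ends s y)ᶜ ∩ (connEvent ends s o)ᶜ ∩ (connEvent ends o y)ᶜ ∩ (connEvent ends u y)ᶜ) + prob q ((connEvent ends s o)ᶜ ∩ connEvent ends s y ∩ connEvent ends s u) ∧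
      prob q (connEvent ends s o ∩ (connEvent ends s u)ᶜ) = prob q (connEvent ends s o ∩ (connEvent ends s y)ᶜ ∩ (connEvent ends s u)ᶜ ∩ (connEvent ends u y)ᶜ) + prob q (connEvent ends s o ∩ (connEvent ends s y)ᶜ ∩ connEvent ends u y) + prob q (connEvent ends s o ∩ connEvent ends s y ∩ (connEvent ends s u)ᶜ) := by
  have hsplit : ∀ (A B : Set (Config E)), prob q A = prob q (A ∩ B) + prob q (A ∩ Bᶜ) :=
    fun A B => (prob_inter_add_prob_inter_compl q A B).symm
  refine ⟨?_, ?_, ?_, ?_, ?_, ?_, ?_⟩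
  · -- (r1) `aᶜ h Y_u = h 𝟙 Y_u`
    congr 1
    ext ω
    simp only [Set.mem_inter_iff, Set.mem_compl_iff, mem_connEvent]
    constructor
    · rintro ⟨⟨hnsu, hso⟩, hyu⟩
      exact ⟨⟨hso, fun hsy => hnsu (conn_trans hsy hyu)⟩, conn_symm hyu⟩
    · rintro ⟨⟨hso, hnsy⟩, huy⟩
      exact ⟨⟨fun hsu => hnsy (conn_trans hsu huy), hso⟩, conn_symm huy⟩
  · -- (r2) `𝟙 hᶜ ℓᶜ = F ⊔ G ⊔ (𝟙 aᶜ hᶜ ℓᶜ Y_uᶜ)`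
    rw [hsplit ((connEvent ends s y)ᶜ ∩ (connEvent ends s o)ᶜ ∩ (connEvent ends y o)ᶜ) (connEvent ends s u), hsplit ((connEvent ends s y)ᶜ ∩ (connEvent ends s o)ᶜ ∩ (connEvent ends y o)ᶜ ∩ (connEvent ends s u)ᶜ) (connEvent ends y u)]
    have e1 : (connEvent ends s y)ᶜ ∩ (connEvent ends s o)ᶜ ∩ (connEvent ends y o)ᶜ ∩ connEvent ends s u = connEvent ends s u ∩ (connEvent ends s y)ᶜ ∩ (connEvent ends s o)ᶜ ∩ (connEvent ends o y)ᶜ ∩ (connEvent ends u y)ᶜ := by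
      ext ω
      simp only [Set.mem_inter_iff, Set.mem_compl_iff, mem_connEvent]
      constructor
      · rintro ⟨⟨⟨hnsy, hnso⟩, hnyo⟩, hsu⟩
        exact ⟨⟨⟨⟨hsu, hnsy⟩, hnso⟩, fun hoy => hnyo (conn_symm hoy)⟩,
          fun huy => hnsy (conn_trans hsu huy)⟩
      · rintro ⟨⟨⟨⟨hsu, hnsy⟩, hnso⟩, hnoy⟩, _⟩
        exact ⟨⟨⟨hnsy, hnso⟩, fun hyo => hnoy (conn_symm hyo)⟩, hsu⟩
    have e2 : (connEvent ends s y)ᶜ ∩ (connEvent ends s o)ᶜ ∩ (connEvent ends y o)ᶜ ∩ (connEvent ends s u)ᶜ ∩ connEvent ends y u = connEvent ends y u ∩ (connEvent ends s y)ᶜ ∩ (connEvent ends y o)ᶜ ∩ (connEvent ends s o)ᶜ := by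
      ext ω
      simp only [Set.mem_inter_iff, Set.mem_compl_iff, mem_connEvent]
      constructor
      · rintro ⟨⟨⟨⟨hnsy, hnso⟩, hnyo⟩, _⟩, hyu⟩
        exact ⟨⟨⟨hyu, hnsy⟩, hnyo⟩, hnso⟩
      · rintro ⟨⟨⟨hyu, hnsy⟩, hnyo⟩, hnso⟩
        exact ⟨⟨⟨⟨hnsy, hnso⟩, hnyo⟩, fun hsu => hnsy (conn_trans hsu (conn_symm hyu))⟩, hyu⟩
    have e3 : (connEvent ends s y)ᶜ ∩ (connEvent ends s o)ᶜ ∩ (connEvent ends y o)ᶜ ∩ (connEvent ends s u)ᶜ ∩ (connEvent ends y u)ᶜ = (connEvent ends s y)ᶜ ∩ (connEvent ends s u)ᶜ ∩ (connEvent ends s o)ᶜ ∩ (connEvent ends y o)ᶜ ∩ (connEvent ends y u)ᶜ := by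
      ext ω; simp only [Set.mem_inter_iff]; tauto
    rw [e1, e2, e3]; ring
  · -- (r3) `hᶜ S = K₅ ⊔ K₃ ⊔ K₁`
    rw [hsplit ((connEvent ends s o)ᶜ ∩ connEvent ends s y) (connEvent ends s u), hsplit ((connEvent ends s o)ᶜ ∩ connEvent ends s y ∩ (connEvent ends s u)ᶜ) (connEvent ends o u)]
    ring
  · -- (r4) `aᶜ S O_u = K₃`
    congr 1
    ext ω
    simp only [Set.mem_inter_iff, Set.mem_compl_iff, mem_connEvent]
    constructor
    · rintro ⟨⟨hnsu, hsy⟩, hou⟩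
      exact ⟨⟨⟨fun hso => hnsu (conn_trans hso hou), hsy⟩, hnsu⟩, hou⟩
    · rintro ⟨⟨⟨_, hsy⟩, hnsu⟩, hou⟩
      exact ⟨⟨hnsu, hsy⟩, hou⟩
  · -- (r5) `aᶜ hᶜ S = K₃ ⊔ K₁`
    rw [hsplit ((connEvent ends s u)ᶜ ∩ (connEvent ends s o)ᶜ ∩ connEvent ends s y) (connEvent ends o u)]
    have e1 : (connEvent ends s u)ᶜ ∩ (connEvent ends s o)ᶜ ∩ connEvent ends s y ∩ connEvent ends o u = (connEvent ends s o)ᶜ ∩ connEvent ends s y ∩ (connEvent ends s u)ᶜ ∩ connEvent ends o u := by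
      ext ω; simp only [Set.mem_inter_iff]; tauto
    have e2 : (connEvent ends s u)ᶜ ∩ (connEvent ends s o)ᶜ ∩ connEvent ends s y ∩ (connEvent ends o u)ᶜ = (connEvent ends s o)ᶜ ∩ connEvent ends s y ∩ (connEvent ends s u)ᶜ ∩ (connEvent ends o u)ᶜ := by
      ext ω; simp only [Set.mem_inter_iff]; tauto
    rw [e1, e2]; ring
  · -- (r6) `a hᶜ = B ⊔ F ⊔ K₅`
    rw [hsplit (connEvent ends s u ∩ (connEvent ends s o)ᶜ) (connEvent ends s y), hsplit (connEvent ends s u ∩ (connEvent ends s o)ᶜ ∩ (connEvent ends s y)ᶜ) (connEvent ends y o)]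
    have e1 : connEvent ends s u ∩ (connEvent ends s o)ᶜ ∩ connEvent ends s y = (connEvent ends s o)ᶜ ∩ connEvent ends s y ∩ connEvent ends s u := by
      ext ω; simp only [Set.mem_inter_iff]; tauto
    have e2 : connEvent ends s u ∩ (connEvent ends s o)ᶜ ∩ (connEvent ends s y)ᶜ ∩ connEvent ends y o = connEvent ends s u ∩ connEvent ends y o ∩ (connEvent ends s y)ᶜ := by
      ext ω
      simp only [Set.mem_inter_iff, Set.mem_compl_iff, mem_connEvent]
      constructor
      · rintro ⟨⟨⟨hsu, _⟩, hnsy⟩, hyo⟩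
        exact ⟨⟨hsu, hyo⟩, hnsy⟩
      · rintro ⟨⟨hsu, hyo⟩, hnsy⟩
        exact ⟨⟨⟨hsu, fun hso => hnsy (conn_trans hso (conn_symm hyo))⟩, hnsy⟩, hyo⟩
    have e3 : connEvent ends s u ∩ (connEvent ends s o)ᶜ ∩ (connEvent ends s y)ᶜ ∩ (connEvent ends y o)ᶜ = connEvent ends s u ∩ (connEvent ends s y)ᶜ ∩ (connEvent ends s o)ᶜ ∩ (connEvent ends o y)ᶜ ∩ (connEvent ends u y)ᶜ := by
      ext ω
      simp only [Set.mem_inter_iff, Set.mem_compl_iff, mem_connEvent]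
      constructor
      · rintro ⟨⟨⟨hsu, hnso⟩, hnsy⟩, hnyo⟩
        exact ⟨⟨⟨⟨hsu, hnsy⟩, hnso⟩, fun hoy => hnyo (conn_symm hoy)⟩,
          fun huy => hnsy (conn_trans hsu huy)⟩
      · rintro ⟨⟨⟨⟨hsu, hnsy⟩, hnso⟩, hnoy⟩, _⟩
        exact ⟨⟨⟨hsu, hnso⟩, hnsy⟩, fun hyo => hnoy (conn_symm hyo)⟩
    rw [e1, e2, e3]; ring
  · -- (r7) `h aᶜ = A ⊔ E ⊔ K₂`
    rw [hsplit (connEvent ends s o ∩ (connEvent ends s u)ᶜ) (connEvent ends s y), hsplit (connEvent ends s o ∩ (connEvent ends s u)ᶜ ∩ (connEvent ends s y)ᶜ) (connEvent ends u y)]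
    have e1 : connEvent ends s o ∩ (connEvent ends s u)ᶜ ∩ connEvent ends s y = connEvent ends s o ∩ connEvent ends s y ∩ (connEvent ends s u)ᶜ := by
      ext ω; simp only [Set.mem_inter_iff]; tauto
    have e2 : connEvent ends s o ∩ (connEvent ends s u)ᶜ ∩ (connEvent ends s y)ᶜ ∩ connEvent ends u y = connEvent ends s o ∩ (connEvent ends s y)ᶜ ∩ connEvent ends u y := by
      ext ω
      simp only [Set.mem_inter_iff, Set.mem_compl_iff, mem_connEvent]
      constructor
      · rintro ⟨⟨⟨hso, _⟩, hnsy⟩, huy⟩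
        exact ⟨⟨hso, hnsy⟩, huy⟩
      · rintro ⟨⟨hso, hnsy⟩, huy⟩
        exact ⟨⟨⟨hso, fun hsu => hnsy (conn_trans hsu huy)⟩, hnsy⟩, huy⟩
    have e3 : connEvent ends s o ∩ (connEvent ends s u)ᶜ ∩ (connEvent ends s y)ᶜ ∩ (connEvent ends u y)ᶜ = connEvent ends s o ∩ (connEvent ends s y)ᶜ ∩ (connEvent ends s u)ᶜ ∩ (connEvent ends u y)ᶜ := by
      ext ω; simp only [Set.mem_inter_iff]; tauto
    rw [e1, e2, e3]; ring

/-- `a + b ≤ t` gives `2·min(a, b) ≤ t`. -/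
lemma two_mul_min_le_of_add_le {a b t : R} (h : a + b ≤ t) : 2 * min a b ≤ t := by
  rcases le_total a b with hab | hab
  · rw [min_eq_left hab]; linarith
  · rw [min_eq_right hab]; linarith

/-- **The `u`-edge case of (UNI-R⁺_o).** For an unpinned edge `f = {x, u}` with `x` in the explored
`o`-component, `2·min(R⁺(p[f↦0]), R⁺(p[f↦1])) ≤ T⁺_f(p)`: the defect `T⁺ − R⁺⁰ − R⁺¹` equals
`(A + E)(B + F) + (F + G)(E + K₂ + K₁)` in closed-world cells. -/
theorem rplus_uni_o_edge_u (p : E → R) (hp : IsProbVec p) (ends : E → Sym2 V) (s y o u x : V) (f : E)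
    (hf : ends f = s(x, u)) (hx : Conn ends (fun e => decide (p e = 1)) o x) (hpf : p f ≠ 1) :
    2 * min ((prob (Function.update p f 0) (connEvent ends s u ∩ clusterInEvent ends s {W : Set V | o ∈ W} ∩ (connEvent ends s y)ᶜ) + prob (Function.update p f 0) (connEvent ends s u ∩ connEvent ends y o ∩ (connEvent ends s y)ᶜ) + prob (Function.update p f 0) ((connEvent ends s y)ᶜ) * prob (Function.update p f 0) (connEvent ends s u ∩ clusterInEvent ends s {W : Set V | o ∈ W}) - (prob (Function.update p f 0) (connEvent ends s u ∩ (connEvent ends s y)ᶜ) * prob (Function.update p f 0) (clusterInEvent ends s {W : Set V | o ∈ W}) + prob (Function.update p f 0) (clusterInEvent ends s {W : Set V | o ∈ W} ∩ (connEvent ends s y)ᶜ) * prob (Function.update p f 0) (connEvent ends s u) + prob (Function.update p f 0) (connEvent ends y o ∩ (connEvent ends s y)ᶜ) * prob (Function.update p f 0) (connEvent ends s u))) + ((prob (Function.update p f 0) ((connEvent ends s u)ᶜ ∩ connEvent ends s o ∩ connEvent ends y u) + prob (Function.update p f 0) ((connEvent ends s u)ᶜ ∩ connEvent ends s y ∩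 connEvent ends o u)) * prob (Function.update p f 0) ((connEvent ends s y)ᶜ ∩ (connEvent ends s o)ᶜ ∩ (connEvent ends y o)ᶜ) + prob (Function.update p f 0) (connEvent ends s o ∩ (connEvent ends s y)ᶜ) * prob (Function.update p f 0) ((connEvent ends s o)ᶜ ∩ connEvent ends s y ∩ connEvent ends s u) - prob (Function.update p f 0) (connEvent ends s u ∩ connEvent ends s o ∩ (connEvent ends s y)ᶜ) * prob (Function.update p f 0) ((connEvent ends s o)ᶜ ∩ connEvent ends s y))) ((prob (Function.update p f 1) (connEvent ends s u ∩ clusterInEvent ends s {W : Set V | o ∈ W} ∩ (connEvent ends s y)ᶜ) + prob (Function.update p f 1) (connEvent ends s u ∩ connEvent ends y o ∩ (connEvent ends s y)ᶜ) + prob (Function.update p f 1) ((connEvent ends s y)ᶜ) * prob (Function.update p f 1) (connEvent ends s u ∩ clusterInEvent ends s {W : Set V | o ∈ W}) - (prob (Function.update p f 1) (connEvent ends s u ∩ (connEvent ends s y)ᶜ) * prob (Function.update p f 1) (clusterInEvent ends s {W : Set V | o ∈ W}) + prob (Function.update p f 1) (clusterInEvent ends s {W : Set V | o ∈ W} ∩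 (connEvent ends s y)ᶜ) * prob (Function.update p f 1) (connEvent ends s u) + prob (Function.update p f 1) (connEvent ends y o ∩ (connEvent ends s y)ᶜ) * prob (Function.update p f 1) (connEvent ends s u))) + ((prob (Function.update p f 1) ((connEvent ends s u)ᶜ ∩ connEvent ends s o ∩ connEvent ends y u) + prob (Function.update p f 1) ((connEvent ends s u)ᶜ ∩ connEvent ends s y ∩ connEvent ends o u)) * prob (Function.update p f 1) ((connEvent ends s y)ᶜ ∩ (connEvent ends s o)ᶜ ∩ (connEvent ends y o)ᶜ) + prob (Function.update p f 1) (connEvent ends s o ∩ (connEvent ends s y)ᶜ) * prob (Function.update p f 1) ((connEvent ends s o)ᶜ ∩ connEvent ends s y ∩ connEvent ends s u) - prob (Function.update p f 1) (connEvent ends s u ∩ connEvent ends s o ∩ (connEvent ends s y)ᶜ) * prob (Function.update p f 1) ((connEvent ends s o)ᶜ ∩ connEvent ends s y))) ≤ (prob (Function.update p f 0) (connEvent ends s u ∩ clusterInEvent ends s {W : Set V | o ∈ W} ∩ (connEvent ends s y)ᶜ) + prob (Function.update p f 1) (connEvent ends s u ∩ clusterInEvent ends s {W : Set V | o ∈ W}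 ∩ (connEvent ends s y)ᶜ) + prob (Function.update p f 0) (connEvent ends s u ∩ connEvent ends y o ∩ (connEvent ends s y)ᶜ) + prob (Function.update p f 1) (connEvent ends s u ∩ connEvent ends y o ∩ (connEvent ends s y)ᶜ) + prob (Function.update p f 0) ((connEvent ends s y)ᶜ) * prob (Function.update p f 1) (connEvent ends s u ∩ clusterInEvent ends s {W : Set V | o ∈ W}) + prob (Function.update p f 1) ((connEvent ends s y)ᶜ) * prob (Function.update p f 0) (connEvent ends s u ∩ clusterInEvent ends s {W : Set V | o ∈ W}) - (prob (Function.update p f 0) (connEvent ends s u ∩ (connEvent ends s y)ᶜ) * prob (Function.update p f 1) (clusterInEvent ends s {W : Set V | o ∈ W}) + prob (Function.update p f 1) (connEvent ends s u ∩ (connEvent ends s y)ᶜ) * prob (Function.update p f 0) (clusterInEvent ends s {W : Set V | o ∈ W}) + prob (Function.update p f 0) (clusterInEvent ends s {W : Set V | o ∈ W} ∩ (connEvent ends s y)ᶜ) * prob (Function.update p f 1) (connEvent ends s u) + prob (Function.update p f 1) (clusterInEvent ends s {W : Set V | o ∈ W} ∩ (connEvent ends s y)ᶜ) * prob (Function.update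 p f 0) (connEvent ends s u) + prob (Function.update p f 0) (connEvent ends y o ∩ (connEvent ends s y)ᶜ) * prob (Function.update p f 1) (connEvent ends s u) + prob (Function.update p f 1) (connEvent ends y o ∩ (connEvent ends s y)ᶜ) * prob (Function.update p f 0) (connEvent ends s u))) + (prob (Function.update p f 0) ((connEvent ends s u)ᶜ ∩ connEvent ends s o ∩ connEvent ends y u) * prob (Function.update p f 1) ((connEvent ends s y)ᶜ ∩ (connEvent ends s o)ᶜ ∩ (connEvent ends y o)ᶜ) + prob (Function.update p f 1) ((connEvent ends s u)ᶜ ∩ connEvent ends s o ∩ connEvent ends y u) * prob (Function.update p f 0) ((connEvent ends s y)ᶜ ∩ (connEvent ends s o)ᶜ ∩ (connEvent ends y o)ᶜ) + prob (Function.update p f 0) ((connEvent ends s u)ᶜ ∩ connEvent ends s y ∩ connEvent ends o u) * prob (Function.update p f 1) ((connEvent ends s y)ᶜ ∩ (connEvent ends s o)ᶜ ∩ (connEvent ends y o)ᶜ) + prob (Function.update p f 1) ((connEvent ends s u)ᶜ ∩ connEvent ends s y ∩ connEvent ends o u) * prob (Function.update p f 0) ((connEvent ends s y)ᶜ ∩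 (connEvent ends s o)ᶜ ∩ (connEvent ends y o)ᶜ) + prob (Function.update p f 0) (connEvent ends s o ∩ (connEvent ends s y)ᶜ) * prob (Function.update p f 1) ((connEvent ends s o)ᶜ ∩ connEvent ends s y ∩ connEvent ends s u) + prob (Function.update p f 1) (connEvent ends s o ∩ (connEvent ends s y)ᶜ) * prob (Function.update p f 0) ((connEvent ends s o)ᶜ ∩ connEvent ends s y ∩ connEvent ends s u) - prob (Function.update p f 0) (connEvent ends s u ∩ connEvent ends s o ∩ (connEvent ends s y)ᶜ) * prob (Function.update p f 1) ((connEvent ends s o)ᶜ ∩ connEvent ends s y) - prob (Function.update p f 1) (connEvent ends s u ∩ connEvent ends s o ∩ (connEvent ends s y)ᶜ) * prob (Function.update p f 0) ((connEvent ends s o)ᶜ ∩ connEvent ends s y)) := by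
  classical
  have hq : IsProbVec (Function.update p f 0) := hp.update f le_rfl zero_le_one
  obtain ⟨t1, t2, t3, t4, t5, t6, t7, t8, t9⟩ := uEdge_transfer p ends s y o u x f hf hx hpf
  obtain ⟨i1, i2, i3, i4, i5, i6, i7, i8, i9⟩ := uEdge_masses (Function.update p f 0) ends s y o u
  obtain ⟨z1, z2, z3, z4, z5⟩ := uEdge_dy_transfer p ends s y o u x f hf hx hpf
  obtain ⟨r1, r2, r3, r4, r5, r6, r7⟩ := uEdge_dy_masses (Function.update p f 0) ends s y o u
  have hh : clusterInEvent ends s {W : Set V | o ∈ W} = connEvent ends s o :=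
    clusterInEvent_mem_eq_connEvent_ycl ends s o
  rw [hh] at t1 t4 t6 t7 ⊢
  rw [t1, t2, t3, t4, t5, t6, t7, t8, t9, z1, z2, z3, z4, z5, i1, i2, i3, i4, i5, i6, i7, i8, i9,
    r1, r2, r3, r4, r5, r6, r7]
  refine two_mul_min_le_of_add_le ?_
  have hA := prob_nonneg hq (connEvent ends s o ∩ (connEvent ends s y)ᶜ ∩ connEvent ends u y)
  have hE := prob_nonneg hq (connEvent ends s o ∩ (connEvent ends s y)ᶜ ∩ (connEvent ends s u)ᶜ ∩ (connEvent ends u y)ᶜ)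
  have hF := prob_nonneg hq (connEvent ends s u ∩ (connEvent ends s y)ᶜ ∩ (connEvent ends s o)ᶜ ∩ (connEvent ends o y)ᶜ ∩ (connEvent ends u y)ᶜ)
  have hG := prob_nonneg hq (connEvent ends y u ∩ (connEvent ends s y)ᶜ ∩ (connEvent ends y o)ᶜ ∩ (connEvent ends s o)ᶜ)
  have hB := prob_nonneg hq (connEvent ends s u ∩ connEvent ends y o ∩ (connEvent ends s y)ᶜ)
  have hk1 := prob_nonneg hq ((connEvent ends s o)ᶜ ∩ connEvent ends s y ∩ (connEvent ends s u)ᶜ ∩ (connEvent ends o u)ᶜ)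
  have hk2 := prob_nonneg hq (connEvent ends s o ∩ connEvent ends s y ∩ (connEvent ends s u)ᶜ)
  generalize prob (Function.update p f 0) (connEvent ends s o ∩ (connEvent ends s y)ᶜ ∩ connEvent ends u y) = vA at hA ⊢
  generalize prob (Function.update p f 0) (connEvent ends s o ∩ (connEvent ends s y)ᶜ ∩ (connEvent ends s u)ᶜ ∩ (connEvent ends u y)ᶜ) = vE at hE ⊢
  generalize prob (Function.update p f 0) (connEvent ends s u ∩ (connEvent ends s y)ᶜ ∩ (connEvent ends s o)ᶜ ∩ (connEvent ends o y)ᶜ ∩ (connEvent ends u y)ᶜ) = vF at hF ⊢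
  generalize prob (Function.update p f 0) (connEvent ends y u ∩ (connEvent ends s y)ᶜ ∩ (connEvent ends y o)ᶜ ∩ (connEvent ends s o)ᶜ) = vG at hG ⊢
  generalize prob (Function.update p f 0) (connEvent ends s u ∩ connEvent ends y o ∩ (connEvent ends s y)ᶜ) = vB at hB ⊢
  generalize prob (Function.update p f 0) ((connEvent ends s o)ᶜ ∩ connEvent ends s y ∩ (connEvent ends s u)ᶜ ∩ (connEvent ends o u)ᶜ) = v1 at hk1 ⊢
  generalize prob (Function.update p f 0) (connEvent ends s o ∩ connEvent ends s y ∩ (connEvent ends s u)ᶜ) = v2 at hk2 ⊢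
  generalize prob (Function.update p f 0) ((connEvent ends s o)ᶜ ∩ connEvent ends s y ∩ (connEvent ends s u)ᶜ ∩ connEvent ends o u) = v3
  generalize prob (Function.update p f 0) ((connEvent ends s o)ᶜ ∩ connEvent ends s y ∩ connEvent ends s u) = v5
  generalize prob (Function.update p f 0) ((connEvent ends s y)ᶜ ∩ (connEvent ends s u)ᶜ ∩ (connEvent ends s o)ᶜ ∩ (connEvent ends y o)ᶜ ∩ (connEvent ends y u)ᶜ) = v6
  generalize prob (Function.update p f 0) (connEvent ends s u ∩ connEvent ends s o ∩ (connEvent ends s y)ᶜ) = w1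
  generalize prob (Function.update p f 0) (connEvent ends s y)ᶜ = w3
  generalize prob (Function.update p f 0) (connEvent ends s u ∩ connEvent ends s o) = w4
  generalize prob (Function.update p f 0) (connEvent ends y o ∩ (connEvent ends s y)ᶜ) = w9
  have key : (w1 + (w1 + vB + vF - vB + vE) + vB + 0 + w3 * (w4 + (vB + vF + v5) + (w4 + (vE + vA + v2)) - w4) + (w3 - vA - vB) * w4 - ((w1 + vB + vF) * (w4 + (vB + vF + v5) + (w4 + (vE + vA + v2)) - w4) + (w1 + vB + vF - vB + vE) * (w4 + (vE + vA + v2)) + (w1 + vA + vE) * (w4 + (vB + vF + v5) + (w4 + (vE + vA + v2)) - w4) + (w1 + vB + vF - vB + vE) * (w4 + (vB + vF + v5)) + w9 * (w4 + (vB + vF + v5) + (w4 + (vE + vA + v2)) - w4) + (w9 - vB + vG) * (w4 + (vB + vF + v5))) + (vA * v6 + 0 * (v6 + vF + vG) + v3 * v6 + (v1 + v3) * (v6 + vF + vG) + (w1 + vA + vE) * 0 + (w1 + vB + vF - vB + vE) * v5 - w1 * (v1 + v3) - (w1 + vB + vF - vB + vE) * (v1 + v5 + v3))) - (w1 + vB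 + w3 * w4 - ((w1 + vB + vF) * (w4 + (vE + vA + v2)) + (w1 + vA + vE) * (w4 + (vB + vF + v5)) + w9 * (w4 + (vB + vF + v5))) + ((vA + v3) * (v6 + vF + vG) + (w1 + vA + vE) * v5 - w1 * (v1 + v5 + v3)) + (w1 + vB + vF - vB + vE + 0 + (w3 - vA - vB) * (w4 + (vB + vF + v5) + (w4 + (vE + vA + v2)) - w4) - ((w1 + vB + vF - vB + vE) * (w4 + (vB + vF + v5) + (w4 + (vE + vA + v2)) - w4) + (w1 + vB + vF - vB + vE) * (w4 + (vB + vF + v5) + (w4 + (vE + vA + v2)) - w4) + (w9 - vB + vG) * (w4 + (vB + vF + v5) + (w4 + (vE + vA + v2)) - w4)) + ((0 + (v1 + v3)) * v6 + (w1 + vB + vF - vB + vE) * 0 - (w1 + vB + vF - vB + vE) * (v1 + v3)))) =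
      (vA + vE) * (vB + vF) + (vF + vG) * (vE + v2 + v1) := by
    ring
  linarith [key, mul_nonneg (add_nonneg hA hE) (add_nonneg hB hF),
    mul_nonneg (add_nonneg hF hG) (add_nonneg (add_nonneg hE hk2) hk1)]

end UEdgePlusProb

end Summit.Ventures.PercRepro2
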